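import Summits.Ventures.PercRepro.C041BlockMapWedge
import Summits.Ventures.PercRepro.C041BlockMapHangTools

/-!
# ROW C-041 — THEOREM (HANG), part 1: the statuses, the merged set and the blocks of a host hung at a vertex of
another host (p6, gen 34)

Setting of `C041BlockMapWedgeHost` / `C041BlockMapWedge` / `C041BlockMapHangTools`.  The host `Zb` (anchor
`a₂`, exits `u₂`) is HUNG at the vertex `v` of the host `Za` (anchor `a₁`, exits `u₁`): the glued host is
`wedge Za Zb v a₂` with the junction `v` (the path lemmas of `C041BlockMapWedgeHost` hold for any junction), its
anchor `inl a₁`, its exits `wexits v a₂ u₁ u₂`.  Against it stands `Za⁺ := Za` with the extra exit `v`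
(`uplus u₁ v`, exits `Option ι₁`).  THE DICTIONARY: a left exit has its `Za`-status; a right exit is merged iff `v`
is merged in `Za` and the exit is merged in `Zb`, reached iff `v` is reached and the exit is reached in `Zb`
(`Mg_hang_inl`, `Mg_hang_inr`, `Rd_hang_inl`, `Rd_hang_inr`).  With the SUBSTITUTION `subst M S` (every `some l`
of `S` replaced by `inl l`, a `none` replaced by the merged exits `M` of `Zb` as `inr`'s), the merged set of the
glued host is the substitution of the merged set of `Za⁺` (`merged_hang`), the block of a left exit is the
substitution of its `Za⁺`-block (`blk_hang_inl`), the block of a right exit merged in `Zb` is the substitution of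
the block of `v` and that of a right exit separated in `Zb` is its `Zb`-block (`blk_hang_inr`), and the blocks of
the glued host are the nonempty substitutions of the blocks of `Za⁺` together with the blocks of `Zb`
(`blocks_hang`).  The product lemmas `prod_subst` and `prod_blocks_hang` read the colouring term of the glued
host off `Za⁺` and `Zb` (part 2, `C041BlockMapHang`).
-/

namespace PercRepro

namespace ZoneZ

namespace MultiExit

open ZoneData Pendant Finset TwoExit TreeClosure

variable {V₁ E₁ U₁ W₁ V₂ E₂ U₂ W₂ : Type} (Za : ZoneData V₁ E₁ U₁ W₁) (Zb : ZoneData V₂ E₂ U₂ W₂)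
  (v : V₁) (a₂ : V₂) [DecidableEq V₂] (a₁ : V₁)
variable {ι₁ ι₂ : Type} (u₁ : ι₁ → V₁) (u₂ : ι₂ → V₂) (ω : E₁ ⊕ E₂ → Bool)

/-! ## The statuses of the exits at the anchor `inl a₁` -/

/-- A left exit is merged iff it is merged in `Za`. -/
theorem Mg_hang_inl (k : ι₁) :
    (wedge Za Zb v a₂).Mg (Sum.inl a₁) (wexits v a₂ u₁ u₂ (Sum.inl k)) ω ↔ Za.Mg a₁ (u₁ k) fun e => ω (Sum.inl e) :=
  Mg_wedge_inl Za Zb v a₂ ω a₁ (u₁ k)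

/-- A right exit is merged iff `v` is merged in `Za` and the exit is merged in `Zb`. -/
theorem Mg_hang_inr (k : ι₂) :
    (wedge Za Zb v a₂).Mg (Sum.inl a₁) (wexits v a₂ u₁ u₂ (Sum.inr k)) ω ↔
      Za.Mg a₁ v (fun e => ω (Sum.inl e)) ∧ Zb.Mg a₂ (u₂ k) fun e => ω (Sum.inr e) :=
  Mg_wedge_inl_red Za Zb v a₂ ω a₁ (u₂ k)

/-- A left exit is reached iff it is reached in `Za`. -/
theorem Rd_hang_inl (k : ι₁) :
    (wedge Za Zb v a₂).Rd (Sum.inl a₁) (wexits v a₂ u₁ u₂ (Sum.inl k)) ω ↔ Za.Rd a₁ (u₁ k) fun e => ω (Sum.inl e) :=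
  Rd_wedge_inl Za Zb v a₂ ω a₁ (u₁ k)

/-- A right exit is reached iff `v` is reached in `Za` and the exit is reached in `Zb`. -/
theorem Rd_hang_inr (k : ι₂) :
    (wedge Za Zb v a₂).Rd (Sum.inl a₁) (wexits v a₂ u₁ u₂ (Sum.inr k)) ω ↔
      Za.Rd a₁ v (fun e => ω (Sum.inl e)) ∧ Zb.Rd a₂ (u₂ k) fun e => ω (Sum.inr e) :=
  Rd_wedge_inl_red Za Zb v a₂ ω a₁ (u₂ k)

/-- Blue connectivity between two left exits. -/
theorem Mg_hang_inl_inl (k l : ι₁) :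
    (wedge Za Zb v a₂).Mg (wexits v a₂ u₁ u₂ (Sum.inl k)) (wexits v a₂ u₁ u₂ (Sum.inl l)) ω ↔
      Za.Mg (u₁ k) (u₁ l) fun e => ω (Sum.inl e) :=
  Mg_wedge_inl Za Zb v a₂ ω (u₁ k) (u₁ l)

/-- Blue connectivity from a left exit to a right exit: through `v`. -/
theorem Mg_hang_inl_inr (k : ι₁) (l : ι₂) :
    (wedge Za Zb v a₂).Mg (wexits v a₂ u₁ u₂ (Sum.inl k)) (wexits v a₂ u₁ u₂ (Sum.inr l)) ω ↔
      Za.Mg (u₁ k) v (fun e => ω (Sum.inl e)) ∧ Zb.Mg a₂ (u₂ l) fun e => ω (Sum.inr e) :=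
  Mg_wedge_inl_red Za Zb v a₂ ω (u₁ k) (u₂ l)

/-- Blue connectivity from a right exit to a left exit: through `v`. -/
theorem Mg_hang_inr_inl (k : ι₂) (l : ι₁) :
    (wedge Za Zb v a₂).Mg (wexits v a₂ u₁ u₂ (Sum.inr k)) (wexits v a₂ u₁ u₂ (Sum.inl l)) ω ↔
      Za.Mg (u₁ l) v (fun e => ω (Sum.inl e)) ∧ Zb.Mg a₂ (u₂ k) fun e => ω (Sum.inr e) :=
  Mg_wedge_red_inl Za Zb v a₂ ω (u₂ k) (u₁ l)

/-- Blue connectivity between two right exits. -/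
theorem Mg_hang_inr_inr (k l : ι₂) :
    (wedge Za Zb v a₂).Mg (wexits v a₂ u₁ u₂ (Sum.inr k)) (wexits v a₂ u₁ u₂ (Sum.inr l)) ω ↔
      Zb.Mg (u₂ k) (u₂ l) fun e => ω (Sum.inr e) :=
  Mg_wedge_red Za Zb v a₂ ω (u₂ k) (u₂ l)

/-! ## The substitution -/

variable [DecidableEq ι₁] [DecidableEq ι₂]

/-- The SUBSTITUTION of a set of slots of `Za⁺`: every `some l` becomes `inl l`, a `none` becomes the set `M`
(the merged exits of `Zb`) as `inr`'s. -/
def subst (M : Finset ι₂) (S : Finset (Option ι₁)) : Finset (ι₁ ⊕ ι₂) :=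
  S.biUnion fun o => o.elim (M.map Function.Embedding.inr) fun l => {Sum.inl l}

/-- A left exit lies in the substitution iff its slot lies in the set. -/
theorem mem_subst_inl (M : Finset ι₂) (S : Finset (Option ι₁)) (l : ι₁) : Sum.inl l ∈ subst M S ↔ some l ∈ S := by
  unfold subst
  rw [Finset.mem_biUnion]
  constructor
  · rintro ⟨o, ho, hl⟩
    rcases o with _ | o
    · rw [Option.elim, Finset.mem_map] at hl
      obtain ⟨m, -, hm⟩ := hl
      rw [Function.Embedding.inr_apply] at hm
      exact absurd hm Sum.inr_ne_inl
    · rw [Option.elim, Finset.mem_singleton] at hl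
      obtain rfl := Sum.inl.inj hl
      exact ho
  · intro h
    exact ⟨some l, h, by rw [Option.elim, Finset.mem_singleton]⟩

/-- A right exit lies in the substitution iff `none` lies in the set and the exit is in `M`. -/
theorem mem_subst_inr (M : Finset ι₂) (S : Finset (Option ι₁)) (m : ι₂) :
    Sum.inr m ∈ subst M S ↔ none ∈ S ∧ m ∈ M := by
  unfold subst
  rw [Finset.mem_biUnion]
  constructor
  · rintro ⟨o, ho, hm⟩
    rcases o with _ | o
    · rw [Option.elim, Finset.mem_map] at hm
      obtain ⟨m', hm', hmm⟩ := hm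
      rw [Function.Embedding.inr_apply] at hmm
      obtain rfl := Sum.inr.inj hmm
      exact ⟨ho, hm'⟩
    · rw [Option.elim, Finset.mem_singleton] at hm
      exact absurd hm Sum.inr_ne_inl
  · rintro ⟨hn, hm⟩
    exact ⟨none, hn, by rw [Option.elim, Finset.mem_map]; exact ⟨m, hm, rfl⟩⟩

/-- The substitution of the empty set. -/
theorem subst_empty (M : Finset ι₂) : subst M (∅ : Finset (Option ι₁)) = ∅ := by
  unfold subst
  rfl

/-- The substitution is injective on sets with a `some`, and on nonempty disjoint sets. -/
theorem subst_eq_subst_inl (M : Finset ι₂) {S S' : Finset (Option ι₁)} (h : subst M S = subst M S') (l : ι₁) :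
    some l ∈ S ↔ some l ∈ S' := by
  rw [← mem_subst_inl M S l, ← mem_subst_inl M S' l, h]

/-- A product over a substitution: the slots, with `none` contributing the product over `M`. -/
theorem prod_subst (M : Finset ι₂) (S : Finset (Option ι₁)) (f : ι₁ ⊕ ι₂ → Vec6) :
    ∏ k ∈ subst M S, f k = ∏ o ∈ S, o.elim (∏ m ∈ M, f (Sum.inr m)) fun l => f (Sum.inl l) := by
  unfold subst
  refine (Finset.prod_biUnion (f := f) (s := S)
    (t := fun o : Option ι₁ => o.elim (M.map Function.Embedding.inr) fun l => {Sum.inl l}) ?_).trans ?_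
  swap
  · refine Finset.prod_congr rfl fun o _ => ?_
    rcases o with _ | o
    · rw [Option.elim, Option.elim, Finset.prod_map]
      rfl
    · rw [Option.elim, Option.elim, Finset.prod_singleton]
  · intro o _ o' _ hne
    rw [Function.onFun, Finset.disjoint_left]
    intro z hz hz'
    rcases o with _ | o <;> rcases o' with _ | o'
    · exact hne rfl
    · rw [Option.elim, Finset.mem_map] at hz
      rw [Option.elim, Finset.mem_singleton] at hz'
      obtain ⟨m, -, hm⟩ := hz
      rw [Function.Embedding.inr_apply] at hm
      rw [hz'] at hm
      exact Sum.inr_ne_inl hm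
    · rw [Option.elim, Finset.mem_singleton] at hz
      rw [Option.elim, Finset.mem_map] at hz'
      obtain ⟨m, -, hm⟩ := hz'
      rw [Function.Embedding.inr_apply] at hm
      rw [hz] at hm
      exact Sum.inr_ne_inl hm
    · rw [Option.elim, Finset.mem_singleton] at hz hz'
      exact hne (by rw [hz] at hz'; rw [Sum.inl.inj hz'])

/-! ## The merged set and the blocks of the glued host -/

variable [Fintype ι₁] [Fintype ι₂]

/-- **The merged set of the glued host** is the substitution of the merged set of `Za⁺`. -/
theorem merged_hang :
    merged (wedge Za Zb v a₂) (wexits v a₂ u₁ u₂) (Sum.inl a₁) ω =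
      subst (merged Zb u₂ a₂ fun e => ω (Sum.inr e)) (merged Za (uplus u₁ v) a₁ fun e => ω (Sum.inl e)) := by
  ext k
  rcases k with k | k
  · rw [mem_subst_inl, mem_merged, mem_merged, Mg_hang_inl, uplus_some]
  · rw [mem_subst_inr, mem_merged, mem_merged, mem_merged, Mg_hang_inr, uplus_none]

/-- **The block of a left exit** is the substitution of its block in `Za⁺`. -/
theorem blk_hang_inl (k : ι₁) :
    blk (wedge Za Zb v a₂) (wexits v a₂ u₁ u₂) (Sum.inl a₁) ω (Sum.inl k) =
      subst (merged Zb u₂ a₂ fun e => ω (Sum.inr e)) (blk Za (uplus u₁ v) a₁ (fun e => ω (Sum.inl e)) (some k)) := by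
  ext l
  rcases l with l | l
  · rw [mem_subst_inl, mem_blk, mem_blk, Mg_hang_inl, Mg_hang_inl_inl, uplus_some, uplus_some]
  · rw [mem_subst_inr, mem_blk, mem_blk, mem_merged, Mg_hang_inr, Mg_hang_inl_inr, uplus_none, uplus_some]
    constructor
    · rintro ⟨h1, h2, h3⟩
      refine ⟨⟨fun h => h1 ⟨h, h3⟩, h2⟩, h3⟩
    · rintro ⟨⟨h1, h2⟩, h3⟩
      exact ⟨fun h => h1 h.1, h2, h3⟩

open Classical in
/-- **The block of a right exit**: the substitution of the block of `v` if the exit is merged in `Zb`, its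
`Zb`-block otherwise. -/
theorem blk_hang_inr (k : ι₂) :
    blk (wedge Za Zb v a₂) (wexits v a₂ u₁ u₂) (Sum.inl a₁) ω (Sum.inr k) =
      if Zb.Mg a₂ (u₂ k) fun e => ω (Sum.inr e) then
        subst (merged Zb u₂ a₂ fun e => ω (Sum.inr e)) (blk Za (uplus u₁ v) a₁ (fun e => ω (Sum.inl e)) none)
      else (blk Zb u₂ a₂ (fun e => ω (Sum.inr e)) k).map Function.Embedding.inr := by
  by_cases hk : Zb.Mg a₂ (u₂ k) fun e => ω (Sum.inr e)
  · rw [if_pos hk]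
    ext l
    rcases l with l | l
    · rw [mem_subst_inl, mem_blk, mem_blk, Mg_hang_inl, Mg_hang_inr_inl, uplus_none, uplus_some]
      constructor
      · rintro ⟨h1, h2, -⟩
        exact ⟨h1, Mg_symm Za _ _ _ h2⟩
      · rintro ⟨h1, h2⟩
        exact ⟨h1, Mg_symm Za _ _ _ h2, hk⟩
    · rw [mem_subst_inr, mem_blk, mem_blk, mem_merged, Mg_hang_inr, Mg_hang_inr_inr, uplus_none]
      constructor
      · rintro ⟨h1, h2⟩
        have h3 : Zb.Mg a₂ (u₂ l) fun e => ω (Sum.inr e) := Mg_trans Zb _ _ _ _ hk h2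
        exact ⟨⟨fun h => h1 ⟨h, h3⟩, Mg_refl Za _ v⟩, h3⟩
      · rintro ⟨⟨h1, -⟩, h3⟩
        exact ⟨fun h => h1 h.1, Mg_trans Zb _ _ _ _ (Mg_symm Zb _ _ _ hk) h3⟩
  · rw [if_neg hk]
    ext l
    rcases l with l | l
    · rw [Finset.mem_map, mem_blk, Mg_hang_inl, Mg_hang_inr_inl]
      constructor
      · rintro ⟨-, -, h3⟩
        exact absurd h3 hk
      · rintro ⟨m, -, hm⟩
        rw [Function.Embedding.inr_apply] at hm
        exact absurd hm Sum.inr_ne_inl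
    · rw [Finset.mem_map, mem_blk, Mg_hang_inr, Mg_hang_inr_inr]
      constructor
      · rintro ⟨h1, h2⟩
        refine ⟨l, (mem_blk Zb u₂ a₂ _ k l).2 ⟨fun h => hk (Mg_trans Zb _ _ _ _ h (Mg_symm Zb _ _ _ h2)), h2⟩, rfl⟩
      · rintro ⟨m, hm, hml⟩
        rw [Function.Embedding.inr_apply] at hml
        obtain rfl := Sum.inr.inj hml
        obtain ⟨h1, h2⟩ := (mem_blk Zb u₂ a₂ _ k m).1 hm
        exact ⟨fun h => h1 h.2, h2⟩

omit [DecidableEq V₂] in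
/-- The block of a left exit contains it (as every block). -/
theorem subst_blk_nonempty_of_sep (k : ι₁) (hk : ¬ Za.Mg a₁ (u₁ k) fun e => ω (Sum.inl e)) :
    (subst (merged Zb u₂ a₂ fun e => ω (Sum.inr e))
      (blk Za (uplus u₁ v) a₁ (fun e => ω (Sum.inl e)) (some k))).Nonempty :=
  ⟨Sum.inl k, (mem_subst_inl _ _ k).2 (self_mem_blk Za (uplus u₁ v) a₁ _ (some k) hk)⟩

open Classical in
/-- **The blocks of the glued host**: the nonempty substitutions of the blocks of `Za⁺`, and the blocks of `Zb`. -/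
theorem blocks_hang :
    blocks (wedge Za Zb v a₂) (wexits v a₂ u₁ u₂) (Sum.inl a₁) ω =
      ((blocks Za (uplus u₁ v) a₁ fun e => ω (Sum.inl e)).image
          (subst (merged Zb u₂ a₂ fun e => ω (Sum.inr e)))).filter (fun B => B.Nonempty) ∪
        (blocks Zb u₂ a₂ fun e => ω (Sum.inr e)).map (Finset.mapEmbedding Function.Embedding.inr).toEmbedding := by
  ext B
  rw [Finset.mem_union, Finset.mem_filter, Finset.mem_image, Finset.mem_map, mem_blocks]
  simp only [RelEmbedding.coe_toEmbedding, Finset.mapEmbedding_apply, mem_blocks]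
  constructor
  · rintro ⟨k, hk, rfl⟩
    rcases k with k | k
    · rw [Mg_hang_inl] at hk
      left
      refine ⟨⟨_, ⟨some k, by rwa [uplus_some], rfl⟩, (blk_hang_inl Za Zb v a₂ a₁ u₁ u₂ ω k).symm⟩, ?_⟩
      rw [blk_hang_inl]
      exact subst_blk_nonempty_of_sep Za Zb v a₂ a₁ u₁ u₂ ω k hk
    · rw [Mg_hang_inr] at hk
      by_cases hk₂ : Zb.Mg a₂ (u₂ k) fun e => ω (Sum.inr e)
      · have hv : ¬ Za.Mg a₁ v fun e => ω (Sum.inl e) := fun h => hk ⟨h, hk₂⟩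
        left
        refine ⟨⟨_, ⟨none, by rwa [uplus_none], rfl⟩, ?_⟩, ?_⟩
        · rw [blk_hang_inr, if_pos hk₂]
        · rw [blk_hang_inr, if_pos hk₂]
          exact ⟨Sum.inr k, (mem_subst_inr _ _ k).2
            ⟨self_mem_blk Za (uplus u₁ v) a₁ _ none hv, (mem_merged Zb u₂ a₂ _ k).2 hk₂⟩⟩
      · right
        refine ⟨_, ⟨k, hk₂, rfl⟩, ?_⟩
        rw [blk_hang_inr, if_neg hk₂]
  · rintro (⟨⟨B₀, ⟨o, ho, rfl⟩, rfl⟩, hne⟩ | ⟨B₂, ⟨k, hk, rfl⟩, rfl⟩)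
    · rcases o with _ | k
      · -- the block of `v`: nonempty, so it contains a left exit of `v`'s component or a merged right exit
        rw [uplus_none] at ho
        obtain ⟨z, hz⟩ := hne
        rcases z with l | m
        · rw [mem_subst_inl] at hz
          refine ⟨Sum.inl l, ?_, ?_⟩
          · rw [Mg_hang_inl]
            exact (((mem_blk Za (uplus u₁ v) a₁ _ none l).1 hz).1)
          · rw [blk_hang_inl, blk_eq_of_mem Za (uplus u₁ v) a₁ _ hz]
        · rw [mem_subst_inr, mem_merged] at hz
          refine ⟨Sum.inr m, ?_, ?_⟩
          · rw [Mg_hang_inr]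
            exact fun h => ho h.1
          · rw [blk_hang_inr, if_pos hz.2]
      · rw [uplus_some] at ho
        refine ⟨Sum.inl k, ?_, (blk_hang_inl Za Zb v a₂ a₁ u₁ u₂ ω k).symm ▸ rfl⟩
        rw [Mg_hang_inl]
        exact ho
    · refine ⟨Sum.inr k, ?_, ?_⟩
      · rw [Mg_hang_inr]
        exact fun h => hk h.2
      · rw [blk_hang_inr, if_neg hk]

omit [DecidableEq V₂] in
/-- The substitution is injective on the blocks of `Za⁺`. -/
theorem subst_injOn_blocks :
    Set.InjOn (subst (merged Zb u₂ a₂ fun e => ω (Sum.inr e)))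
      (↑(blocks Za (uplus u₁ v) a₁ fun e => ω (Sum.inl e)) : Set (Finset (Option ι₁))) := by
  intro B hB B' hB' h
  rw [Finset.mem_coe] at hB hB'
  by_contra hne
  have hdis := blocks_pairwise Za (uplus u₁ v) a₁ _ B hB B' hB' hne
  -- no `some l` lies in `B` (it would lie in `B'` too), so `B ⊆ {none}`; likewise `B'`
  have hB0 : ∀ l, some l ∉ B := fun l hl =>
    Finset.disjoint_left.1 hdis hl ((subst_eq_subst_inl _ h l).1 hl)
  have hB0' : ∀ l, some l ∉ B' := fun l hl =>
    Finset.disjoint_left.1 hdis ((subst_eq_subst_inl _ h l).2 hl) hl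
  obtain ⟨k, hk, rfl⟩ := (mem_blocks _ _ _ _ B).1 hB
  obtain ⟨k', hk', rfl⟩ := (mem_blocks _ _ _ _ B').1 hB'
  have hkn : k = none := by
    rcases k with _ | k
    · rfl
    · exact absurd (self_mem_blk Za (uplus u₁ v) a₁ _ (some k) hk) (hB0 k)
  have hkn' : k' = none := by
    rcases k' with _ | k'
    · rfl
    · exact absurd (self_mem_blk Za (uplus u₁ v) a₁ _ (some k') hk') (hB0' k')
  subst hkn hkn'
  exact hne rfl

omit [DecidableEq V₂] in
/-- The two families of blocks of the glued host are disjoint. -/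
theorem blocks_hang_disjoint :
    Disjoint
      (((blocks Za (uplus u₁ v) a₁ fun e => ω (Sum.inl e)).image
          (subst (merged Zb u₂ a₂ fun e => ω (Sum.inr e)))).filter (fun B => B.Nonempty))
      ((blocks Zb u₂ a₂ fun e => ω (Sum.inr e)).map (Finset.mapEmbedding Function.Embedding.inr).toEmbedding) := by
  rw [Finset.disjoint_left]
  intro B hB₁ hB₂
  rw [Finset.mem_filter, Finset.mem_image] at hB₁
  rw [Finset.mem_map] at hB₂
  obtain ⟨⟨B₀, -, rfl⟩, hne⟩ := hB₁
  obtain ⟨B₂, hB₂, hB⟩ := hB₂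
  simp only [RelEmbedding.coe_toEmbedding, Finset.mapEmbedding_apply] at hB
  obtain ⟨k, hk, rfl⟩ := (mem_blocks _ _ _ _ B₂).1 hB₂
  obtain ⟨z, hz⟩ := hne
  rcases z with l | m
  · rw [← hB, Finset.mem_map] at hz
    obtain ⟨m, -, hm⟩ := hz
    rw [Function.Embedding.inr_apply] at hm
    exact Sum.inr_ne_inl hm
  · have hz' := hz
    rw [← hB, Finset.mem_map] at hz'
    obtain ⟨m', hm', hmm⟩ := hz'
    rw [Function.Embedding.inr_apply] at hmm
    obtain rfl := Sum.inr.inj hmm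
    rw [mem_subst_inr, mem_merged] at hz
    exact ((mem_blk Zb u₂ a₂ _ k m').1 hm').1 hz.2

/-- **The product over the blocks of the glued host**: over the blocks of `Za⁺` (substituted) and over the blocks
of `Zb`. -/
theorem prod_blocks_hang (f : ι₁ ⊕ ι₂ → Vec6) :
    ∏ B ∈ blocks (wedge Za Zb v a₂) (wexits v a₂ u₁ u₂) (Sum.inl a₁) ω, thR (∏ k ∈ B, f k) =
      (∏ B ∈ blocks Za (uplus u₁ v) a₁ fun e => ω (Sum.inl e),
          thR (∏ k ∈ subst (merged Zb u₂ a₂ fun e => ω (Sum.inr e)) B, f k)) *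
        ∏ B ∈ blocks Zb u₂ a₂ fun e => ω (Sum.inr e), thR (∏ m ∈ B, f (Sum.inr m)) := by
  classical
  rw [blocks_hang, Finset.prod_union (blocks_hang_disjoint Za Zb v a₂ a₁ u₁ u₂ ω), Finset.prod_map]
  have h1 : ∏ B ∈ ((blocks Za (uplus u₁ v) a₁ fun e => ω (Sum.inl e)).image
      (subst (merged Zb u₂ a₂ fun e => ω (Sum.inr e)))).filter (fun B => B.Nonempty), thR (∏ k ∈ B, f k) =
      ∏ B ∈ (blocks Za (uplus u₁ v) a₁ fun e => ω (Sum.inl e)).image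
        (subst (merged Zb u₂ a₂ fun e => ω (Sum.inr e))), thR (∏ k ∈ B, f k) := by
    refine Finset.prod_filter_of_ne fun B _ hB => ?_
    by_contra hemp
    rw [Finset.not_nonempty_iff_eq_empty] at hemp
    rw [hemp, Finset.prod_empty, thR_one] at hB
    exact hB rfl
  rw [h1, Finset.prod_image (subst_injOn_blocks Za Zb v a₂ a₁ u₁ u₂ ω)]
  simp only [RelEmbedding.coe_toEmbedding, Finset.mapEmbedding_apply, Finset.prod_map,
    Function.Embedding.inr_apply]

end MultiExit

end ZoneZ

end PercRepro
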